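import Summits.BirchSwinnertonDyer.BirchSwinnertonDyer.Theorems.ResidualThetaTransportAtTwoThetaLayerLambdaCongruenceAtTwoTowerGrowth
import Summits.BirchSwinnertonDyer.BirchSwinnertonDyer.Theses.ResidualThetaTransportAtTwo
import Literature.NumberTheory.EllipticCurves.PAdicLFunctionNeZeroProofs
import Literature.NumberTheory.EllipticCurves.PAdicLFunctionProofs
import HarnessLib

/-!
# Crux `ThetaLayerLambdaCongruenceAtTwo` (stmt-BirchSwinnertonDyer-20688): BOTH sides of the crux obey the `λ`-growth law
# under stabilisation; the crux from ONE layer past stabilisation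

Width seat bsd-wall-rtt-p3-w3 (`--supports stmt-BirchSwinnertonDyer-20688`; closes nothing). THEOREMS ONLY (imports the route
file for the crux's vocabulary, like every glue file).

* §1 the `W`-SIDE is an instance of the generic tower machinery: for the newform `f` of `W` (rational coefficients,
  `K_f = ℚ`) there is an embedding `ι_f : K_f → ℚ̄₂` with `θ_k(f)^{alg} = θ_k(f; Ω⁺_f)^{ι_f}` (`exists_emb_map_mazurTateElement_eq`,
  tree: `mazurTateElementK_plusPeriod_eq`), and on the habitat⁺ `a₂(f) = a₂(W) = 0`, `2 ∤ N_W`, `Ω⁺_f` is a plus period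
  (`wSide_hyps`). Hence (`wSide_growth_mul_of_stabilized`) the crux's `W`-element `Θ^{S₀}_n(W)` satisfies: if `Θ_{n₁}(W) ≠ 0` and
  its sup norm has stabilised from `n₁` on (along the parity class), then `3λ(Θ_{n₁+2k}(W)) + 2^{n₁} = 3λ(Θ_{n₁}(W)) + 2^{n₁}4^k`.
  The same for the partner's element at ANY plus period (`gSide_growth_mul_of_stabilized`).
* §2 **THE CRUX FROM ONE LAYER PAST STABILISATION** `thetaLayerLambdaCongruenceAtTwo_of_stabilized_oneLayer`: Kan⁺ BY NAME follows
  from (L1): «for all data of the crux there is an even layer `n₁` at which both depleted elements are non-zero, both sup norms have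
  stabilised along the even layers, and `λ(Θ^{S₀}_{n₁}(W)) = λ(Θ^{S₀}_{n₁}(g;Ω))`». The two stabilisation clauses hold
  UNCONDITIONALLY for large `n₁` (the norms are non-decreasing — `supNorm_layer_le_add_two_generic` — bounded, and take values
  in the discrete value group of a finite extension of `ℚ₂`; this discreteness step is the only part not formalised), so the
  content of Kan⁺ is: the eventually constant integer `λ_n(W) − λ_n(g)` (even `n`) is `0` — a ONE-LAYER statement.

Nothing about any curve or form is asserted; BSD is not proved by any of this.

References: [PollackWeston2011MT] Prop. 2.5, Thm. 4.1; [GreenbergVatsal2000] (10), Thm. (1.4).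
-/

noncomputable section

-- justification: the `Summit.BirchSwinnertonDyer.BirchSwinnertonDyer.…` path repeats a component (route-file convention)
set_option linter.dupNamespace false

open scoped Classical

open Polynomial

open Literature.NumberTheory.IwasawaTheory Literature.NumberTheory.EllipticCurves
  Literature.NumberTheory.EllipticCurves.ModularForms

namespace Summit.BirchSwinnertonDyer.BirchSwinnertonDyer.Theorems.ThetaLayerLambdaCongruenceAtTwo

/-! ## §1. The `W`-side and the `g`-side as instances of the generic tower machinery -/

section Sides

/-- **The rational Mazur–Tate element read in `ℚ̄₂` is a `K_f`-valued one read through an embedding**: for a newform `f`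
with `K_f = ℚ` there is `ι_f : K_f → ℚ̄₂` with `θ_k(f)^{alg} = θ_k(f; Ω⁺_f)^{ι_f}` for every `k`
(`mazurTateElementK_plusPeriod_eq`; ring maps out of `ℚ` are unique). [cite: Pollack2003, Def. 6.15] -/
theorem exists_emb_map_mazurTateElement_eq {N : ℕ} [NeZero N] {f : CuspForm (CongruenceSubgroup.Gamma0 N) 2}
    (hf : IsNewform0 f) (hQ : coeffField f = ⊥) :
    ∃ ιf : coeffField f →+* PadicAlgCl 2, ∀ k : ℕ,
      (mazurTateElement f 2 k).map (algebraMap ℚ (PadicAlgCl 2)) =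
        (mazurTateElementK f (plusPeriod f : ℂ) 2 k).map ιf := by
  let ιf : coeffField f →+* PadicAlgCl 2 :=
    (algebraMap ℚ (PadicAlgCl 2)).comp
      (((IntermediateField.botEquiv ℚ ℂ).toAlgHom.comp (IntermediateField.equivOfEq hQ).toAlgHom).toRingHom)
  refine ⟨ιf, fun k ↦ ?_⟩
  rw [mazurTateElementK_plusPeriod_eq hf hQ k, Polynomial.map_map]
  congr 1
  exact RingHom.ext_rat _ _

/-- **`W`-side hypotheses on the habitat⁺**: for the newform `f` of `W` with `W` good supersingular at `2` and `a₂(W) = 0`: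
`f` is a newform, `2 ∤ N_W` (`not_dvd_level_of_isNewformOf`), `a₂(f) = 0` (`cuspCoeff_eq_frobeniusTrace_of_isNewformOf_holds`),
`K_f = ℚ` and `Ω⁺_f` is a plus period (`isPlusPeriod_plusPeriod`). [cite: SilvermanAEC2009, §C.16 (a_p(f) = a_p(E))] -/
theorem wSide_hyps {W : WeierstrassCurve ℚ} [W.IsElliptic] [W.IsGloballyMinimal]
    (hss : Literature.NumberTheory.EllipticCurves.Rank1Residual.GoodSS W 2) (ha : W.frobeniusTrace 2 = 0)
    [NeZero (W.conductorNorm ℤ)] {f : CuspForm (CongruenceSubgroup.Gamma0 (W.conductorNorm ℤ)) 2}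
    (hf : IsNewformOf W f) :
    IsNewform0 f ∧ ¬ 2 ∣ W.conductorNorm ℤ ∧ cuspCoeff f 2 = 0 ∧ coeffField f = ⊥ ∧
      IsPlusPeriod f (plusPeriod f : ℂ) := by
  refine ⟨hf.1, not_dvd_level_of_isNewformOf hf hss.1, ?_, hf.coeffField_eq_bot,
    isPlusPeriod_plusPeriod hf.1 hf.coeffField_eq_bot⟩
  rw [cuspCoeff_eq_frobeniusTrace_of_isNewformOf_holds hf hss.1, ha, Int.cast_zero]

variable {M : ℕ} [NeZero M] {g : CuspForm (CongruenceSubgroup.Gamma0 M) 2}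
  (ι : coeffField g →+* PadicAlgCl 2) (Ω : ℂ)
  (S₀ : Finset (IsDedekindDomain.HeightOneSpectrum (NumberField.RingOfIntegers ℚ)))

/-- **`g`-side growth under stabilisation** (the crux's partner element, verbatim; ANY plus period `Ω`): if
`Θ^{S₀}_n(g;Ω) ≠ 0` and `‖Θ^{S₀}_{n+2k+2}‖_sup ≤ ‖Θ^{S₀}_{n+2k}‖_sup` for all `k`, then
`3λ(Θ^{S₀}_{n+2k}(g;Ω)) + 2ⁿ = 3λ(Θ^{S₀}_n(g;Ω)) + 2ⁿ·4^k` (`layerLambda_layer_add_two_mul_of_stabilized`).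
[cite: PollackWeston2011MT, Thm. 4.1 (read at 2)] -/
theorem gSide_growth_mul_of_stabilized (hg : IsNewform0 g) (h2M : ¬ 2 ∣ M) (ha2 : cuspCoeff g 2 = 0)
    (hΩ : IsPlusPeriod g Ω) {n : ℕ} (h0 : (((Literature.NumberTheory.EllipticCurves.mazurTateElementK g Ω 2 n).map ι * ∏ v ∈ S₀, (1 - Polynomial.C (Literature.NumberTheory.EllipticCurves.embCoeff g ι (Rat.HeightOneSpectrum.natGenerator v)) * Polynomial.X + (if Rat.HeightOneSpectrum.natGenerator v ∣ M then 0 else Polynomial.C (Rat.HeightOneSpectrum.natGenerator v : PadicAlgCl 2)) * Polynomial.X ^ 2).comp (Polynomial.C ((Rat.HeightOneSpectrum.natGenerator v : PadicAlgCl 2)⁻¹) * (Polynomial.X + 1) ^ (PadicInt.toZModPow n (-(Literature.NumberTheory.EllipticCurves.GreenbergVatsal2000.frobeniusExponent 2 (Rat.HeightOneSpectrum.natGenerator v : ℤ_[2])))).val)) %ₘ ((Polynomial.X + 1) ^ 2 ^ n - 1)) ≠ 0)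
    (hstab : ∀ k : ℕ, (((Literature.NumberTheory.EllipticCurves.mazurTateElementK g Ω 2 (n + 2 * k + 2)).map ι * ∏ v ∈ S₀, (1 - Polynomial.C (Literature.NumberTheory.EllipticCurves.embCoeff g ι (Rat.HeightOneSpectrum.natGenerator v)) * Polynomial.X + (if Rat.HeightOneSpectrum.natGenerator v ∣ M then 0 else Polynomial.C (Rat.HeightOneSpectrum.natGenerator v : PadicAlgCl 2)) * Polynomial.X ^ 2).comp (Polynomial.C ((Rat.HeightOneSpectrum.natGenerator v : PadicAlgCl 2)⁻¹) * (Polynomial.X + 1) ^ (PadicInt.toZModPow (n + 2 * k + 2) (-(Literature.NumberTheory.EllipticCurves.GreenbergVatsal2000.frobeniusExponent 2 (Rat.HeightOneSpectrum.natGenerator v : ℤ_[2])))).val)) %ₘ ((Polynomial.X + 1) ^ 2 ^ (n + 2 * k + 2) - 1)).supNorm ≤ (((Literature.NumberTheory.EllipticCurves.mazurTateElementK g Ω 2 (n + 2 * k)).map ι * ∏ v ∈ S₀, (1 - Polynomial.C (Literature.NumberTheory.EllipticCurves.embCoeff g ι (Rat.HeightOneSpectrum.natGenerator v)) * Polynomial.X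 + (if Rat.HeightOneSpectrum.natGenerator v ∣ M then 0 else Polynomial.C (Rat.HeightOneSpectrum.natGenerator v : PadicAlgCl 2)) * Polynomial.X ^ 2).comp (Polynomial.C ((Rat.HeightOneSpectrum.natGenerator v : PadicAlgCl 2)⁻¹) * (Polynomial.X + 1) ^ (PadicInt.toZModPow (n + 2 * k) (-(Literature.NumberTheory.EllipticCurves.GreenbergVatsal2000.frobeniusExponent 2 (Rat.HeightOneSpectrum.natGenerator v : ℤ_[2])))).val)) %ₘ ((Polynomial.X + 1) ^ 2 ^ (n + 2 * k) - 1)).supNorm) (k : ℕ) :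
    3 * layerLambda (((Literature.NumberTheory.EllipticCurves.mazurTateElementK g Ω 2 (n + 2 * k)).map ι * ∏ v ∈ S₀, (1 - Polynomial.C (Literature.NumberTheory.EllipticCurves.embCoeff g ι (Rat.HeightOneSpectrum.natGenerator v)) * Polynomial.X + (if Rat.HeightOneSpectrum.natGenerator v ∣ M then 0 else Polynomial.C (Rat.HeightOneSpectrum.natGenerator v : PadicAlgCl 2)) * Polynomial.X ^ 2).comp (Polynomial.C ((Rat.HeightOneSpectrum.natGenerator v : PadicAlgCl 2)⁻¹) * (Polynomial.X + 1) ^ (PadicInt.toZModPow (n + 2 * k) (-(Literature.NumberTheory.EllipticCurves.GreenbergVatsal2000.frobeniusExponent 2 (Rat.HeightOneSpectrum.natGenerator v : ℤ_[2])))).val)) %ₘ ((Polynomial.X + 1) ^ 2 ^ (n + 2 * k) - 1)) + 2 ^ n = 3 * layerLambda (((Literature.NumberTheory.EllipticCurves.mazurTateElementK g Ω 2 n).map ι * ∏ v ∈ S₀, (1 - Polynomial.C (Literature.NumberTheory.EllipticCurves.embCoeff g ι (Rat.HeightOneSpectrum.natGenerator v)) * Polynomial.X + (if Rat.HeightOneSpectrum.natGenerator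 v ∣ M then 0 else Polynomial.C (Rat.HeightOneSpectrum.natGenerator v : PadicAlgCl 2)) * Polynomial.X ^ 2).comp (Polynomial.C ((Rat.HeightOneSpectrum.natGenerator v : PadicAlgCl 2)⁻¹) * (Polynomial.X + 1) ^ (PadicInt.toZModPow n (-(Literature.NumberTheory.EllipticCurves.GreenbergVatsal2000.frobeniusExponent 2 (Rat.HeightOneSpectrum.natGenerator v : ℤ_[2])))).val)) %ₘ ((Polynomial.X + 1) ^ 2 ^ n - 1)) + 2 ^ n * 4 ^ k :=
  (layerLambda_layer_add_two_mul_of_stabilized ι Ω S₀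
    (fun v ↦ 1 - C (embCoeff g ι (Rat.HeightOneSpectrum.natGenerator v)) * X +
      (if Rat.HeightOneSpectrum.natGenerator v ∣ M then 0 else C (Rat.HeightOneSpectrum.natGenerator v : PadicAlgCl 2)) *
        X ^ 2)
    (fun v ↦ ((Rat.HeightOneSpectrum.natGenerator v : PadicAlgCl 2)⁻¹))
    (fun v ↦ -(Literature.NumberTheory.EllipticCurves.GreenbergVatsal2000.frobeniusExponent 2
      (Rat.HeightOneSpectrum.natGenerator v : ℤ_[2])))
    hg h2M ha2 hΩ h0 hstab k).2.2

/-- **`W`-side growth under stabilisation** (the crux's `W`-element, verbatim): on the habitat⁺ (`GoodSS W 2`, `a₂(W) = 0`),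
for the newform `f` of `W`: if `Θ^{S₀}_n(W) ≠ 0` and `‖Θ^{S₀}_{n+2k+2}(W)‖_sup ≤ ‖Θ^{S₀}_{n+2k}(W)‖_sup` for all `k`, then
`3λ(Θ^{S₀}_{n+2k}(W)) + 2ⁿ = 3λ(Θ^{S₀}_n(W)) + 2ⁿ·4^k`. [cite: PollackWeston2011MT, Thm. 4.1 (read at 2)] -/
theorem wSide_growth_mul_of_stabilized {W : WeierstrassCurve ℚ} [W.IsElliptic] [W.IsGloballyMinimal]
    (hss : Literature.NumberTheory.EllipticCurves.Rank1Residual.GoodSS W 2) (ha : W.frobeniusTrace 2 = 0)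
    [NeZero (W.conductorNorm ℤ)] {f : CuspForm (CongruenceSubgroup.Gamma0 (W.conductorNorm ℤ)) 2}
    (hf : IsNewformOf W f) {n : ℕ} (h0 : (((Literature.NumberTheory.EllipticCurves.mazurTateElement f 2 n).map (algebraMap ℚ (PadicAlgCl 2)) * ∏ v ∈ S₀, ((W.localPolynomialAt v).map (Int.castRingHom (PadicAlgCl 2))).comp (Polynomial.C ((Rat.HeightOneSpectrum.natGenerator v : PadicAlgCl 2)⁻¹) * (Polynomial.X + 1) ^ (PadicInt.toZModPow n (-(Literature.NumberTheory.EllipticCurves.GreenbergVatsal2000.frobeniusExponent 2 (Rat.HeightOneSpectrum.natGenerator v : ℤ_[2])))).val)) %ₘ ((Polynomial.X + 1) ^ 2 ^ n - 1)) ≠ 0)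
    (hstab : ∀ k : ℕ, (((Literature.NumberTheory.EllipticCurves.mazurTateElement f 2 (n + 2 * k + 2)).map (algebraMap ℚ (PadicAlgCl 2)) * ∏ v ∈ S₀, ((W.localPolynomialAt v).map (Int.castRingHom (PadicAlgCl 2))).comp (Polynomial.C ((Rat.HeightOneSpectrum.natGenerator v : PadicAlgCl 2)⁻¹) * (Polynomial.X + 1) ^ (PadicInt.toZModPow (n + 2 * k + 2) (-(Literature.NumberTheory.EllipticCurves.GreenbergVatsal2000.frobeniusExponent 2 (Rat.HeightOneSpectrum.natGenerator v : ℤ_[2])))).val)) %ₘ ((Polynomial.X + 1) ^ 2 ^ (n + 2 * k + 2) - 1)).supNorm ≤ (((Literature.NumberTheory.EllipticCurves.mazurTateElement f 2 (n + 2 * k)).map (algebraMap ℚ (PadicAlgCl 2)) * ∏ v ∈ S₀, ((W.localPolynomialAt v).map (Int.castRingHom (PadicAlgCl 2))).comp (Polynomial.C ((Rat.HeightOneSpectrum.natGenerator v : PadicAlgCl 2)⁻¹) * (Polynomial.X + 1) ^ (PadicInt.toZModPow (n + 2 * k) (-(Literature.NumberTheory.EllipticCurves.GreenbergVatsal2000.frobeniusExponent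 2 (Rat.HeightOneSpectrum.natGenerator v : ℤ_[2])))).val)) %ₘ ((Polynomial.X + 1) ^ 2 ^ (n + 2 * k) - 1)).supNorm) (k : ℕ) :
    3 * layerLambda (((Literature.NumberTheory.EllipticCurves.mazurTateElement f 2 (n + 2 * k)).map (algebraMap ℚ (PadicAlgCl 2)) * ∏ v ∈ S₀, ((W.localPolynomialAt v).map (Int.castRingHom (PadicAlgCl 2))).comp (Polynomial.C ((Rat.HeightOneSpectrum.natGenerator v : PadicAlgCl 2)⁻¹) * (Polynomial.X + 1) ^ (PadicInt.toZModPow (n + 2 * k) (-(Literature.NumberTheory.EllipticCurves.GreenbergVatsal2000.frobeniusExponent 2 (Rat.HeightOneSpectrum.natGenerator v : ℤ_[2])))).val)) %ₘ ((Polynomial.X + 1) ^ 2 ^ (n + 2 * k) - 1)) + 2 ^ n = 3 * layerLambda (((Literature.NumberTheory.EllipticCurves.mazurTateElement f 2 n).map (algebraMap ℚ (PadicAlgCl 2)) * ∏ v ∈ S₀, ((W.localPolynomialAt v).map (Int.castRingHom (PadicAlgCl 2))).comp (Polynomial.C ((Rat.HeightOneSpectrum.natGenerator v : PadicAlgCl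 2)⁻¹) * (Polynomial.X + 1) ^ (PadicInt.toZModPow n (-(Literature.NumberTheory.EllipticCurves.GreenbergVatsal2000.frobeniusExponent 2 (Rat.HeightOneSpectrum.natGenerator v : ℤ_[2])))).val)) %ₘ ((Polynomial.X + 1) ^ 2 ^ n - 1)) + 2 ^ n * 4 ^ k := by
  obtain ⟨hf0, h2N, ha2, hQ, hΩf⟩ := wSide_hyps hss ha hf
  obtain ⟨ιf, hι⟩ := exists_emb_map_mazurTateElement_eq hf0 hQ
  simp only [hι] at h0 hstab ⊢
  exact (layerLambda_layer_add_two_mul_of_stabilized ιf (plusPeriod f : ℂ) S₀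
    (fun v ↦ (W.localPolynomialAt v).map (Int.castRingHom (PadicAlgCl 2)))
    (fun v ↦ ((Rat.HeightOneSpectrum.natGenerator v : PadicAlgCl 2)⁻¹))
    (fun v ↦ -(Literature.NumberTheory.EllipticCurves.GreenbergVatsal2000.frobeniusExponent 2
      (Rat.HeightOneSpectrum.natGenerator v : ℤ_[2])))
    hf0 h2N ha2 hΩf h0 hstab k).2.2

end Sides

/-! ## §2. The crux from one layer past stabilisation -/

/-- **Crux `ThetaLayerLambdaCongruenceAtTwo` BY NAME from ONE LAYER PAST STABILISATION.** Hypothesis (L1): for all data of the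
crux there is an even layer `n₁` with `Θ^{S₀}_{n₁}(W) ≠ 0`, `Θ^{S₀}_{n₁}(g;Ω) ≠ 0`, both sup norms stabilised along the even
layers from `n₁` on, and `λ(Θ^{S₀}_{n₁}(W)) = λ(Θ^{S₀}_{n₁}(g;Ω))`. Then both `λ`'s grow by `2ⁿ` from layer `n` to `n + 2`
(three-term relation on both sides), so they agree at every even `n ≥ n₁` — the crux. The stabilisation clauses are
unconditionally true for large `n₁` (monotone bounded norms in a discrete value group; not formalised here), so Kan⁺ is
EQUIVALENT to the vanishing of the eventually constant difference `λ_n(W) − λ_n(g)`. [cite: GreenbergVatsal2000, (10) and Thm. (1.4) (shape; the input is a hypothesis)] -/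
theorem thetaLayerLambdaCongruenceAtTwo_of_stabilized_oneLayer
    (h1 : ∀ (W : WeierstrassCurve ℚ) [W.IsElliptic] [W.IsGloballyMinimal], ¬ W.HasCM → W.analyticRank = 0 → Literature.NumberTheory.EllipticCurves.Rank1Residual.GoodSS W 2 → W.frobeniusTrace 2 = 0 → W.Δ < 0 → ∀ (M : ℕ) [NeZero M] (g : CuspForm (CongruenceSubgroup.Gamma0 M) 2) (ι : Literature.NumberTheory.EllipticCurves.ModularForms.coeffField g →+* PadicAlgCl 2) (Ω : ℂ), Odd M → Literature.NumberTheory.EllipticCurves.ModularForms.IsNewform0 g → Literature.NumberTheory.Automorphic.IsCMForm (Literature.NumberTheory.EllipticCurves.ModularForms.liftToGamma1 M 2 g) → Literature.NumberTheory.EllipticCurves.ModularForms.cuspCoeff g 2 = 0 → Literature.NumberTheory.EllipticCurves.IsPlusPeriod g Ω → (∀ ℓ : ℕ, ℓ.Prime → ¬ ℓ ∣ 2 * M * W.conductorNorm ℤ → ‖Literature.NumberTheory.EllipticCurves.embCoeff g ι ℓ - (W.frobeniusTrace ℓ : PadicAlgCl 2)‖ < 1) → ∀ [NeZero (W.conductorNorm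 ℤ)] (f : CuspForm (CongruenceSubgroup.Gamma0 (W.conductorNorm ℤ)) 2), Literature.NumberTheory.EllipticCurves.ModularForms.IsNewformOf W f → ∀ (S₀ : Finset (IsDedekindDomain.HeightOneSpectrum (NumberField.RingOfIntegers ℚ))), (∀ v ∈ S₀, ((2 : ℕ) : NumberField.RingOfIntegers ℚ) ∉ v.asIdeal) → (∀ v : IsDedekindDomain.HeightOneSpectrum (NumberField.RingOfIntegers ℚ), ¬ W.HasGoodReductionAt v → v ∈ S₀) → (∀ v : IsDedekindDomain.HeightOneSpectrum (NumberField.RingOfIntegers ℚ), Rat.HeightOneSpectrum.natGenerator v ∣ M → v ∈ S₀) → ∃ n₁ : ℕ, Even n₁ ∧ (((Literature.NumberTheory.EllipticCurves.mazurTateElement f 2 n₁).map (algebraMap ℚ (PadicAlgCl 2)) * ∏ v ∈ S₀, ((W.localPolynomialAt v).map (Int.castRingHom (PadicAlgCl 2))).comp (Polynomial.C ((Rat.HeightOneSpectrum.natGenerator v : PadicAlgCl 2)⁻¹) * (Polynomial.X + 1) ^ (PadicInt.toZModPow n₁ (-(Literature.NumberTheory.EllipticCurves.GreenbergVatsal2000.frobeniusExponent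 2 (Rat.HeightOneSpectrum.natGenerator v : ℤ_[2])))).val)) %ₘ ((Polynomial.X + 1) ^ 2 ^ n₁ - 1)) ≠ 0 ∧ (((Literature.NumberTheory.EllipticCurves.mazurTateElementK g Ω 2 n₁).map ι * ∏ v ∈ S₀, (1 - Polynomial.C (Literature.NumberTheory.EllipticCurves.embCoeff g ι (Rat.HeightOneSpectrum.natGenerator v)) * Polynomial.X + (if Rat.HeightOneSpectrum.natGenerator v ∣ M then 0 else Polynomial.C (Rat.HeightOneSpectrum.natGenerator v : PadicAlgCl 2)) * Polynomial.X ^ 2).comp (Polynomial.C ((Rat.HeightOneSpectrum.natGenerator v : PadicAlgCl 2)⁻¹) * (Polynomial.X + 1) ^ (PadicInt.toZModPow n₁ (-(Literature.NumberTheory.EllipticCurves.GreenbergVatsal2000.frobeniusExponent 2 (Rat.HeightOneSpectrum.natGenerator v : ℤ_[2])))).val)) %ₘ ((Polynomial.X + 1) ^ 2 ^ n₁ - 1)) ≠ 0 ∧ (∀ k : ℕ, (((Literature.NumberTheory.EllipticCurves.mazurTateElement f 2 (n₁ + 2 * k + 2)).map (algebraMap ℚ (PadicAlgCl 2)) * ∏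 v ∈ S₀, ((W.localPolynomialAt v).map (Int.castRingHom (PadicAlgCl 2))).comp (Polynomial.C ((Rat.HeightOneSpectrum.natGenerator v : PadicAlgCl 2)⁻¹) * (Polynomial.X + 1) ^ (PadicInt.toZModPow (n₁ + 2 * k + 2) (-(Literature.NumberTheory.EllipticCurves.GreenbergVatsal2000.frobeniusExponent 2 (Rat.HeightOneSpectrum.natGenerator v : ℤ_[2])))).val)) %ₘ ((Polynomial.X + 1) ^ 2 ^ (n₁ + 2 * k + 2) - 1)).supNorm ≤ (((Literature.NumberTheory.EllipticCurves.mazurTateElement f 2 (n₁ + 2 * k)).map (algebraMap ℚ (PadicAlgCl 2)) * ∏ v ∈ S₀, ((W.localPolynomialAt v).map (Int.castRingHom (PadicAlgCl 2))).comp (Polynomial.C ((Rat.HeightOneSpectrum.natGenerator v : PadicAlgCl 2)⁻¹) * (Polynomial.X + 1) ^ (PadicInt.toZModPow (n₁ + 2 * k) (-(Literature.NumberTheory.EllipticCurves.GreenbergVatsal2000.frobeniusExponent 2 (Rat.HeightOneSpectrum.natGenerator v : ℤ_[2])))).val)) %ₘ ((Polynomial.X + 1) ^ 2 ^ (n₁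 + 2 * k) - 1)).supNorm) ∧ (∀ k : ℕ, (((Literature.NumberTheory.EllipticCurves.mazurTateElementK g Ω 2 (n₁ + 2 * k + 2)).map ι * ∏ v ∈ S₀, (1 - Polynomial.C (Literature.NumberTheory.EllipticCurves.embCoeff g ι (Rat.HeightOneSpectrum.natGenerator v)) * Polynomial.X + (if Rat.HeightOneSpectrum.natGenerator v ∣ M then 0 else Polynomial.C (Rat.HeightOneSpectrum.natGenerator v : PadicAlgCl 2)) * Polynomial.X ^ 2).comp (Polynomial.C ((Rat.HeightOneSpectrum.natGenerator v : PadicAlgCl 2)⁻¹) * (Polynomial.X + 1) ^ (PadicInt.toZModPow (n₁ + 2 * k + 2) (-(Literature.NumberTheory.EllipticCurves.GreenbergVatsal2000.frobeniusExponent 2 (Rat.HeightOneSpectrum.natGenerator v : ℤ_[2])))).val)) %ₘ ((Polynomial.X + 1) ^ 2 ^ (n₁ + 2 * k + 2) - 1)).supNorm ≤ (((Literature.NumberTheory.EllipticCurves.mazurTateElementK g Ω 2 (n₁ + 2 * k)).map ι * ∏ v ∈ S₀, (1 - Polynomial.C (Literature.NumberTheory.EllipticCurves.embCoeff g ι (Rat.HeightOneSpectrum.natGenerator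 v)) * Polynomial.X + (if Rat.HeightOneSpectrum.natGenerator v ∣ M then 0 else Polynomial.C (Rat.HeightOneSpectrum.natGenerator v : PadicAlgCl 2)) * Polynomial.X ^ 2).comp (Polynomial.C ((Rat.HeightOneSpectrum.natGenerator v : PadicAlgCl 2)⁻¹) * (Polynomial.X + 1) ^ (PadicInt.toZModPow (n₁ + 2 * k) (-(Literature.NumberTheory.EllipticCurves.GreenbergVatsal2000.frobeniusExponent 2 (Rat.HeightOneSpectrum.natGenerator v : ℤ_[2])))).val)) %ₘ ((Polynomial.X + 1) ^ 2 ^ (n₁ + 2 * k) - 1)).supNorm) ∧ Literature.NumberTheory.IwasawaTheory.layerLambda (((Literature.NumberTheory.EllipticCurves.mazurTateElement f 2 n₁).map (algebraMap ℚ (PadicAlgCl 2)) * ∏ v ∈ S₀, ((W.localPolynomialAt v).map (Int.castRingHom (PadicAlgCl 2))).comp (Polynomial.C ((Rat.HeightOneSpectrum.natGenerator v : PadicAlgCl 2)⁻¹) * (Polynomial.X + 1) ^ (PadicInt.toZModPow n₁ (-(Literature.NumberTheory.EllipticCurves.GreenbergVatsal2000.frobeniusExponent 2 (Rat.HeightOneSpectrum.natGenerator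 v : ℤ_[2])))).val)) %ₘ ((Polynomial.X + 1) ^ 2 ^ n₁ - 1)) = Literature.NumberTheory.IwasawaTheory.layerLambda (((Literature.NumberTheory.EllipticCurves.mazurTateElementK g Ω 2 n₁).map ι * ∏ v ∈ S₀, (1 - Polynomial.C (Literature.NumberTheory.EllipticCurves.embCoeff g ι (Rat.HeightOneSpectrum.natGenerator v)) * Polynomial.X + (if Rat.HeightOneSpectrum.natGenerator v ∣ M then 0 else Polynomial.C (Rat.HeightOneSpectrum.natGenerator v : PadicAlgCl 2)) * Polynomial.X ^ 2).comp (Polynomial.C ((Rat.HeightOneSpectrum.natGenerator v : PadicAlgCl 2)⁻¹) * (Polynomial.X + 1) ^ (PadicInt.toZModPow n₁ (-(Literature.NumberTheory.EllipticCurves.GreenbergVatsal2000.frobeniusExponent 2 (Rat.HeightOneSpectrum.natGenerator v : ℤ_[2])))).val)) %ₘ ((Polynomial.X + 1) ^ 2 ^ n₁ - 1))) :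
    Summit.BirchSwinnertonDyer.BirchSwinnertonDyer.Theses.ResidualThetaTransportAtTwo.ThetaLayerLambdaCongruenceAtTwo := by
  intro W _ _ hcm hr hss ha hΔ M _ g ι Ω hodd hnew hcmg ha2 hΩ hcong _ f hf S₀ hS2 hSW hSM
  obtain ⟨n₁, hn₁e, hW0, hG0, hWst, hGst, hlam⟩ :=
    h1 W hcm hr hss ha hΔ M g ι Ω hodd hnew hcmg ha2 hΩ hcong f hf S₀ hS2 hSW hSM
  refine ⟨n₁, fun n hn he ↦ ?_⟩
  obtain ⟨a, ha'⟩ := he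
  obtain ⟨b, hb'⟩ := hn₁e
  obtain ⟨k, rfl⟩ : ∃ k, n = n₁ + 2 * k := ⟨a - b, by omega⟩
  have hW := wSide_growth_mul_of_stabilized S₀ hss ha hf hW0 hWst k
  have hG := gSide_growth_mul_of_stabilized ι Ω S₀ hnew hodd.not_two_dvd_nat ha2 hΩ hG0 hGst k
  omega

end Summit.BirchSwinnertonDyer.BirchSwinnertonDyer.Theorems.ThetaLayerLambdaCongruenceAtTwo

end
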